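import Summits.QuantumFields.YangMills.Theorems.CovariantDischargeSweepActionVariation
import HarnessLib

/-!
# Line «sandwich_discharge» on crux `HistoryTailL` (stmt-QuantumFields-19936), stub `stub_sandwichSweepGapCapped` — brick B1′:
# the SHARP quadratic cost of a left sweep, `1 − reTr H_p ≤ ½·(‖linCobd_p‖ + (6t_p² + 4t_p³ + t_p⁴))²`

Cell `ym3-torus` (YM ladder rung R3 = continuum SU(2) Yang–Mills on the three-torus — a RUNG, NOT the Clay problem), width seat
`ym3-torus-px8` gen 6, `--supports` only (helper).  The rev-0 sweep letters ✓`CovariantDischargeSweepActionVariation` expand the action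
change of a left sweep `W ↦ E·W` as `A(W) − A(E·W) = Σ_p Λ_p − Σ_p (1 − reTr H_p) + O(Σ_p (6t_p²+4t_p³+t_p⁴)·dist1 W_p)` and bound the
QUADRATIC COST by the crude `Σ_p (1 − reTr H_p) ≤ 8·Σ_p t_p²` (`t_p` = the size of the four sweep factors on `∂p`).  For the Cameron–Martin
profile of the capped sweep stub (LOCATE-SWGAP-px8g6 §4 B1: amplitude 1-form `a` with `‖a‖₂² ≍ L^{3j}` but `‖da‖₂² ≍ L^{j}`) the crude bound
charges `‖a‖²` where only `‖da‖²` is due: the four factors on `∂p` nearly CANCEL and what survives to first order is the linearised twisted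
coboundary `linCobd_p` (`≈ (da)_p·X` + frame defect for a covariantly framed sweep).  THIS FILE is the sharp replacement, pure algebra over
✓`ApproxLift.norm_twistedCobd_sub_one_sub_lin_le` and ✓`MatrixNorms.two_mul_one_sub_nReTr_le_opDist1_sq`:
* `dist1_twistedCobd_le_norm_lin_add` — `dist1 H_p ≤ ‖linCobd_p‖ + (6t_p² + 4t_p³ + t_p⁴)`;
* ★`one_sub_reTr_twistedCobd_le_sharp` — `1 − reTr H_p ≤ ½·(‖linCobd_p‖ + (6t_p² + 4t_p³ + t_p⁴))²`, and its sum;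
* ★★`lin_sub_sharp_le_wilsonAction4_sub_mulField` — the MAIN LETTER's lower half with the sharp cost:
  `Σ_p Λ_p − Σ_p (6t_p²+4t_p³+t_p⁴)·dist1 W_p − ½·Σ_p (‖linCobd_p‖ + 6t_p²+4t_p³+t_p⁴)² ≤ A(W) − A(E·W)`, and the `β`-scaled premise shape
  `le_mul_wilsonAction4_sub_mulField_sharp` of ✓`CovariantDischargeSweepGapReduction.gibbsK_real_le_exp_neg_of_gap`.
WHAT THIS IS NOT: nothing here chooses the sweep or bounds `‖linCobd_p‖` by `|(da)_p|` (that is the frame bookkeeping of the capped stub);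
nothing of `stub_sandwichSweepGapCapped`, the crux `HistoryTailL`, the rung R3, d = 4, a continuum limit or a mass gap is proved.  YM₃ on T³
is rung R3, NOT the Clay problem.  References: T. Bałaban, CMP **109** (1987) 249–301 [Balaban1987RG1] ((0.2) p.252, (0.14) p.254);
CMP **98** (1985) 17–51 [Balaban1985Averaging] ((19)–(20) p.21).  Elementary algebra ([folklore]).
-/

noncomputable section

open scoped BigOperators Matrix.Norms.L2Operator

namespace Summit.QuantumFields.YangMills.Theorems.CovariantDischargeSweepSharpQuadraticCost

open Literature.MathematicalPhysics.QuantumFieldTheory.Balaban1983to89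
open Literature.MathematicalPhysics.QuantumFieldTheory.Balaban1983to89.UnitaryModel (nReTr opDist1)
open Summit.QuantumFields.YangMills.Theorems.ApproxLift (mulField twistedCobd linCobd norm_twistedCobd_sub_one_sub_lin_le)
open Summit.QuantumFields.YangMills.Theorems.CovariantDischargeSweepActionVariation
  (one_sub_reTr_le_half_dist1_sq abs_wilsonAction4_sub_mulField_add_quad_sub_lin_le)

variable {P : Params} {j : ℕ} {n : Type*} [Fintype n] [DecidableEq n] [Nonempty n]

/-- `dist1 H_p ≤ ‖linCobd_p‖ + (6t_p² + 4t_p³ + t_p⁴)`: the twisted coboundary is its linearisation up to the second-order remainder of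
✓`ApproxLift.norm_twistedCobd_sub_one_sub_lin_le`. [cite: Balaban1985Averaging, (20) p.21] -/
theorem dist1_twistedCobd_le_norm_lin_add (E W : GaugeField P j (Matrix.specialUnitaryGroup n ℂ)) (p : Plaq P j) {t : ℝ}
    (h₁ : dist1 (E ⟨p.src, p.μ⟩) ≤ t) (h₂ : dist1 (E ⟨p.src.shift p.μ, p.ν⟩) ≤ t) (h₃ : dist1 (E ⟨p.src.shift p.ν, p.μ⟩) ≤ t)
    (h₄ : dist1 (E ⟨p.src, p.ν⟩) ≤ t) :
    dist1 (twistedCobd E W p) ≤ ‖linCobd E W p‖ + (6 * t ^ 2 + 4 * t ^ 3 + t ^ 4) := by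
  have hrem := norm_twistedCobd_sub_one_sub_lin_le E W p h₁ h₂ h₃ h₄
  have hd : dist1 (twistedCobd E W p) = ‖((twistedCobd E W p : Matrix.specialUnitaryGroup n ℂ) : Matrix n n ℂ) - 1‖ := rfl
  rw [hd]
  calc ‖((twistedCobd E W p : Matrix.specialUnitaryGroup n ℂ) : Matrix n n ℂ) - 1‖
      = ‖linCobd E W p + ((((twistedCobd E W p : Matrix.specialUnitaryGroup n ℂ) : Matrix n n ℂ) - 1) - linCobd E W p)‖ := by
        rw [add_sub_cancel]
    _ ≤ ‖linCobd E W p‖ + ‖(((twistedCobd E W p : Matrix.specialUnitaryGroup n ℂ) : Matrix n n ℂ) - 1) - linCobd E W p‖ :=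
        norm_add_le _ _
    _ ≤ ‖linCobd E W p‖ + (6 * t ^ 2 + 4 * t ^ 3 + t ^ 4) := add_le_add le_rfl hrem

/-- ★ **THE SHARP QUADRATIC COST, ONE PLAQUETTE**: `1 − reTr H_p ≤ ½·(‖linCobd_p‖ + (6t_p² + 4t_p³ + t_p⁴))²` — what the crude
`8t_p²` of ✓`sum_one_sub_reTr_twistedCobd_le_SU` loses when the four sweep factors on `∂p` nearly cancel. [cite: Balaban1987RG1, (0.14) p.254] -/
theorem one_sub_reTr_twistedCobd_le_sharp (E W : GaugeField P j (Matrix.specialUnitaryGroup n ℂ)) (p : Plaq P j) {t : ℝ}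
    (h₁ : dist1 (E ⟨p.src, p.μ⟩) ≤ t) (h₂ : dist1 (E ⟨p.src.shift p.μ, p.ν⟩) ≤ t) (h₃ : dist1 (E ⟨p.src.shift p.ν, p.μ⟩) ≤ t)
    (h₄ : dist1 (E ⟨p.src, p.ν⟩) ≤ t) :
    1 - reTr (twistedCobd E W p) ≤ 1 / 2 * (‖linCobd E W p‖ + (6 * t ^ 2 + 4 * t ^ 3 + t ^ 4)) ^ 2 := by
  have hq := one_sub_reTr_le_half_dist1_sq (twistedCobd E W p)
  have hd := dist1_twistedCobd_le_norm_lin_add E W p h₁ h₂ h₃ h₄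
  have hd0 : 0 ≤ dist1 (twistedCobd E W p) := GaugeGroup.dist1_nonneg _
  nlinarith [hd, hd0]

/-- The sharp quadratic cost, summed over plaquettes. [cite: Balaban1987RG1, (0.14) p.254] -/
theorem sum_one_sub_reTr_twistedCobd_le_sharp (E W : GaugeField P j (Matrix.specialUnitaryGroup n ℂ)) {t : Plaq P j → ℝ}
    (h₁ : ∀ p : Plaq P j, dist1 (E ⟨p.src, p.μ⟩) ≤ t p) (h₂ : ∀ p : Plaq P j, dist1 (E ⟨p.src.shift p.μ, p.ν⟩) ≤ t p)
    (h₃ : ∀ p : Plaq P j, dist1 (E ⟨p.src.shift p.ν, p.μ⟩) ≤ t p) (h₄ : ∀ p : Plaq P j, dist1 (E ⟨p.src, p.ν⟩) ≤ t p) :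
    ∑ p : Plaq P j, (1 - reTr (twistedCobd E W p)) ≤
      1 / 2 * ∑ p : Plaq P j, (‖linCobd E W p‖ + (6 * t p ^ 2 + 4 * t p ^ 3 + t p ^ 4)) ^ 2 := by
  rw [Finset.mul_sum]
  exact Finset.sum_le_sum fun p _ => one_sub_reTr_twistedCobd_le_sharp E W p (h₁ p) (h₂ p) (h₃ p) (h₄ p)

/-- ★★ **MAIN LETTER, LOWER HALF, SHARP COST**: `Σ_p Λ_p − Σ_p (6t_p²+4t_p³+t_p⁴)·dist1 W(∂p) − ½·Σ_p (‖linCobd_p‖ + 6t_p²+4t_p³+t_p⁴)²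
≤ A(W) − A(E·W)` — undoing the sweep lowers the action by at least «linear statistic − second-order remainder − SHARP quadratic cost».
[cite: Balaban1987RG1, (0.2) p.252] -/
theorem lin_sub_sharp_le_wilsonAction4_sub_mulField (E W : GaugeField P j (Matrix.specialUnitaryGroup n ℂ)) {t : Plaq P j → ℝ}
    (h₁ : ∀ p : Plaq P j, dist1 (E ⟨p.src, p.μ⟩) ≤ t p) (h₂ : ∀ p : Plaq P j, dist1 (E ⟨p.src.shift p.μ, p.ν⟩) ≤ t p)
    (h₃ : ∀ p : Plaq P j, dist1 (E ⟨p.src.shift p.ν, p.μ⟩) ≤ t p) (h₄ : ∀ p : Plaq P j, dist1 (E ⟨p.src, p.ν⟩) ≤ t p) :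
    (∑ p : Plaq P j, nReTr (linCobd E W p * (((GaugeField.plaqHol W p : Matrix.specialUnitaryGroup n ℂ) : Matrix n n ℂ) - 1))) -
        (∑ p : Plaq P j, (6 * t p ^ 2 + 4 * t p ^ 3 + t p ^ 4) * dist1 (GaugeField.plaqHol W p)) -
        1 / 2 * ∑ p : Plaq P j, (‖linCobd E W p‖ + (6 * t p ^ 2 + 4 * t p ^ 3 + t p ^ 4)) ^ 2 ≤
      wilsonAction4 W - wilsonAction4 (mulField E W) := by
  have h := (abs_le.mp (abs_wilsonAction4_sub_mulField_add_quad_sub_lin_le E W h₁ h₂ h₃ h₄)).1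
  have hq := sum_one_sub_reTr_twistedCobd_le_sharp E W h₁ h₂ h₃ h₄
  linarith

/-- The `β`-scaled premise shape `m ≤ β·(A(V) − A(Ψ′V))` of ✓`CovariantDischargeSweepGapReduction.gibbsK_real_le_exp_neg_of_gap`
with `Ψ′V = E·V` and the SHARP cost. [cite: Balaban1985UV3, (1)-(3) p.256] -/
theorem le_mul_wilsonAction4_sub_mulField_sharp {β m : ℝ} (hβ : 0 ≤ β) (E V : GaugeField P j (Matrix.specialUnitaryGroup n ℂ))
    {t : Plaq P j → ℝ}
    (h₁ : ∀ p : Plaq P j, dist1 (E ⟨p.src, p.μ⟩) ≤ t p) (h₂ : ∀ p : Plaq P j, dist1 (E ⟨p.src.shift p.μ, p.ν⟩) ≤ t p)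
    (h₃ : ∀ p : Plaq P j, dist1 (E ⟨p.src.shift p.ν, p.μ⟩) ≤ t p) (h₄ : ∀ p : Plaq P j, dist1 (E ⟨p.src, p.ν⟩) ≤ t p)
    (hm : m ≤ β * ((∑ p : Plaq P j, nReTr (linCobd E V p *
        (((GaugeField.plaqHol V p : Matrix.specialUnitaryGroup n ℂ) : Matrix n n ℂ) - 1))) -
        (∑ p : Plaq P j, (6 * t p ^ 2 + 4 * t p ^ 3 + t p ^ 4) * dist1 (GaugeField.plaqHol V p)) -
        1 / 2 * ∑ p : Plaq P j, (‖linCobd E V p‖ + (6 * t p ^ 2 + 4 * t p ^ 3 + t p ^ 4)) ^ 2)) :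
    m ≤ β * (wilsonAction4 V - wilsonAction4 (mulField E V)) :=
  hm.trans (mul_le_mul_of_nonneg_left (lin_sub_sharp_le_wilsonAction4_sub_mulField E V h₁ h₂ h₃ h₄) hβ)

/-- A usable envelope of the sharp cost: `(x + r)² ≤ 2x² + 2r²`, so `½Σ(‖linCobd_p‖ + r_p)² ≤ Σ‖linCobd_p‖² + Σ r_p²` — the cost is
the `ℓ²` norm of the LINEARISED coboundary plus a fourth-order term in the sweep size. [folklore] -/
theorem half_sum_sq_add_le (f r : Plaq P j → ℝ) :
    1 / 2 * ∑ p : Plaq P j, (f p + r p) ^ 2 ≤ ∑ p : Plaq P j, f p ^ 2 + ∑ p : Plaq P j, r p ^ 2 := by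
  rw [← Finset.sum_add_distrib, Finset.mul_sum]
  refine Finset.sum_le_sum fun p _ => ?_
  nlinarith [sq_nonneg (f p - r p)]

end Summit.QuantumFields.YangMills.Theorems.CovariantDischargeSweepSharpQuadraticCost

end
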